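import Literature.NumberTheory.PAdicHodge.DeRhamOfTatePtOPeriods
import Literature.NumberTheory.PAdicHodge.AinfRamifiedOmegaPeriodHom
import Literature.NumberTheory.PAdicHodge.AinfRamifiedOmegaPeriodNonvanishingVarpi
import Literature.NumberTheory.PAdicHodge.AinfWeierstrassRamifiedCellsWitness
import HarnessLib

/-!
# hDR for the explicit good supersingular `𝒪_D`-models of K★'s additive cells, modulo ONE η-period homomorphism (proofs only)

Topic `Literature/NumberTheory/PAdicHodge`; namespace `Literature.NumberTheory.PAdicHodge`. THEOREMS ONLY (no definition, no named
fact, no instance, no `sorry`). Assembly of the ramified road (R1) of the de Rham input `hDR|ss` for the three potentially supersingular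
cells (5; IV*), (5; II*), (7; III*) of BSD route EdixhovenFibreFiveSeven (crux K★ `stmt-BirchSwinnertonDyer-22226`, memo
`Cruxes/StarredOptimalManinUnitFiveSeven/Lines/kato-lever-hDR-R1-models-descent.md` §5–§6), up to the η-period:

for the explicit model `W_D = ⟨0, 0, 0, a ϱ^{r₄}, b ϱ^{r₆}⟩` over `𝒪_D = ℤ_p[X]/(X^e − p)` with the cell numerology and
`64a³p^{t₄} + 432b²p^{t₆} ∈ ℤ_pˣ`, and any bridge `ψ : 𝒪_D → 𝒪_F` compatible with `𝒪_D → F`, the socket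
`isDeRham_restrictedRationalTateRep_of_periodHomsO` (file `DeRhamOfTatePtOPeriods`) is fed with
* the matching at good supersingular reduction (`Δ ∈ 𝒪_Fˣ`, `A_p = 0`: `isUnit_Δ_map_model`, `hasseCoeff_red_map_model_eq_zero`,
  file `AinfWeierstrassRamifiedCellsWitness`),
* `φ₁ := ∫ω = AinfRamTop.omegaPeriodHomO` (`ℤ_p`-linear, `Γ_F`-equivariant, in `Fil¹`: file `AinfRamifiedOmegaPeriodHom`) with its
  non-vanishing (N1′) `omegaPeriod_model_{five,seven}_ne_zero` (file `AinfRamifiedOmegaPeriodNonvanishingVarpi`) at the Tate-module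
  witness `τ₁ ≠ 0` of `exists_tatePtO_norm_p_lt_norm_pow_model`,
* an ABSTRACT second homomorphism `φ₂` (`ℤ_p`-homogeneous, `Γ_F`-equivariant, `∉ Fil¹` somewhere) — to be instantiated by the η-period
  over `A_inf(𝒪)` (files `AinfRamifiedEtaPeriod*`, in progress).

* **`isDeRham_restrictedRationalTateRep_of_explicitModel_of_etaHom`** — the explicit-model capstone `hR'` of
  `Summits/…/EdixhovenFibreFiveSevenStarredOptimalManinUnitFiveSevenSupersingularCellsExplicit` GRANTED `φ₂`.

BSD / K★ are not proved by any of this; K★ stays OPEN ⟸ {P1, hT₂, hR'}.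

## References
* [Fontaine1982FormesDifferentielles] J.-M. Fontaine, Invent. Math. 65 (1982), §5.
* [Colmez1992PeriodesAbeliennes] P. Colmez, Math. Ann. 292 (1992), §2.
* [SilvermanAEC2009] J. H. Silverman, *AEC* (2009), IV.7.5, VII.2.2, VII.5.5.
* [SerreLocalFields1979] J.-P. Serre, *Local Fields* (1979), Ch. II §5.
-/

noncomputable section

open scoped Classical
open Field ValuativeRel Polynomial

namespace Literature.NumberTheory.PAdicHodge

open Literature Literature.NumberTheory.GaloisRepresentations Literature.NumberTheory.EllipticCurves
open Literature.NumberTheory.GaloisRepresentations.IsNonarchimedeanLocalField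
open Literature.NumberTheory.GaloisRepresentations.LubinTate

variable {F : Type} [Field F] [ValuativeRel F] [TopologicalSpace F] [IsNonarchimedeanLocalField F] [CharZero F]
  {p : ℕ} [Fact p.Prime] [Fact (¬ IsUnit (p : integerC F))] [IsAdicComplete (Ideal.span {(p : integerC F)}) (integerC F)]

omit [Fact (¬ IsUnit (p : integerC F))] [IsAdicComplete (Ideal.span {(p : integerC F)}) (integerC F)] in
/-- `(W_D ⊗_ψ 𝒪_F) ⊗ F = W_D ⊗_{𝒪_D} F` for `W_D` over `𝒪_D` read over `CoeffDisc D` and a bridge `ψ : 𝒪_D → 𝒪_F` compatible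
with `𝒪_D → F`. [cite: SilvermanAEC2009, VII.§1] -/
theorem AinfRamTop.curveFO_map_of_map_ψ {hp : valuation F p < 1} {D : EisensteinRoot F p hp} (WD : WeierstrassCurve D.Coeff)
    (ψ : EisensteinRoot.CoeffDisc D →+* LTCoeff F) (hψ : ∀ c, algebraMap (LTCoeff F) F (ψ c) = EisensteinRoot.CoeffDisc.toF D c) :
    AinfTop.curveFO F ((WD.map (EisensteinRoot.CoeffDisc.of D).toRingHom).map ψ) = WD.map (EisensteinRoot.Coeff.toF D) := by
  rw [AinfTop.curveFO, AinfRamTop.map_ψ_map_algebraMap _ ψ hψ, WeierstrassCurve.map_map]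
  exact congrArg WD.map (RingHom.ext fun x => rfl)

/-- **The explicit-model capstone `hR'` modulo the η-period.** Let `D = (X^e − p, ϖ)` be an Eisenstein datum of the `p`-adic field
`F` (`p ∈ {5, 7}`), `W_D = ⟨0, 0, 0, a ϱ^{r₄}, b ϱ^{r₆}⟩` over `𝒪_D` with the cell numerology
`(p; e, r₄, r₆, t₄, t₆) ∈ {(5; 3,1,0,1,0), (5; 6,4,0,2,0), (7; 4,0,2,0,1)}`, `3r₄ = e t₄`, `2r₆ = e t₆`,
`64a³p^{t₄} + 432b²p^{t₆} ∈ ℤ_pˣ`, and `W₀/K₀` (`K₀ ⊆ F`) with `W₀ ×_{K₀} F = W_D ⊗_{𝒪_D} F`. Let `ψ : 𝒪_D → 𝒪_F` be compatible with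
`𝒪_D → F`, `W = W_D` read over `CoeffDisc D`, and suppose given ONE more additive map `φ₂ : T_pŴ♭(𝒪_{ℂ_F}) → B_dR⁺(F)`
(`W♭ = W ⊗_ψ 𝒪_F`) which is `ℤ_p`-homogeneous, `Γ_F`-equivariant and misses `Fil¹` somewhere (intended: `∫η`). Then
`restrictedRationalTateRep W₀ F p` is de Rham for `bdRPeriodRingData hp`: `φ₁ = ∫ω` (`omegaPeriodHomO`) is `ℤ_p`-linear,
equivariant, in `Fil¹`, and nonzero at the Tate-module point `τ` with `τ₁ ≠ 0` ((N1′) `omegaPeriod_model_{five,seven}_ne_zero`);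
the matching holds at good supersingular reduction (`isUnit_Δ_map_model`, `hasseCoeff_red_map_model_eq_zero`); socket
`isDeRham_restrictedRationalTateRep_of_periodHomsO`. BSD is not proved by this.
[cite: Fontaine1982FormesDifferentielles, §5] [cite: Colmez1992PeriodesAbeliennes, §2] [cite: SilvermanAEC2009, VII.2.2] -/
theorem isDeRham_restrictedRationalTateRep_of_explicitModel_of_etaHom
    (hp : valuation F p < 1) [Algebra ℚ_[p] F] (D : EisensteinRoot F p hp) {e : ℕ} (hD : D.poly = X ^ e - C (p : ℤ_[p]))
    {K₀ : Type} [Field K₀] [CharZero K₀] [Algebra K₀ F] (W₀ : WeierstrassCurve K₀) [W₀.IsElliptic]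
    (a b : ℤ_[p]) (r₄ r₆ t₄ t₆ : ℕ)
    (hcell : p = 5 ∧ (e = 3 ∧ r₄ = 1 ∧ r₆ = 0 ∧ t₄ = 1 ∧ t₆ = 0 ∨ e = 6 ∧ r₄ = 4 ∧ r₆ = 0 ∧ t₄ = 2 ∧ t₆ = 0) ∨
      p = 7 ∧ e = 4 ∧ r₄ = 0 ∧ r₆ = 2 ∧ t₄ = 0 ∧ t₆ = 1)
    (h₄ : 3 * r₄ = e * t₄) (h₆ : 2 * r₆ = e * t₆) (hu : IsUnit (64 * a ^ 3 * (p : ℤ_[p]) ^ t₄ + 432 * b ^ 2 * (p : ℤ_[p]) ^ t₆))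
    (hW : W₀.baseChange F = (⟨0, 0, 0, AdjoinRoot.of D.poly a * AdjoinRoot.root D.poly ^ r₄,
      AdjoinRoot.of D.poly b * AdjoinRoot.root D.poly ^ r₆⟩ : WeierstrassCurve D.Coeff).map (EisensteinRoot.Coeff.toF D))
    (ψ : EisensteinRoot.CoeffDisc D →+* LTCoeff F) (hψ : ∀ c, algebraMap (LTCoeff F) F (ψ c) = EisensteinRoot.CoeffDisc.toF D c)
    (φ₂ : AinfTop.TatePtO F ((((⟨0, 0, 0, AdjoinRoot.of D.poly a * AdjoinRoot.root D.poly ^ r₄,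
      AdjoinRoot.of D.poly b * AdjoinRoot.root D.poly ^ r₆⟩ : WeierstrassCurve D.Coeff).map
      (EisensteinRoot.CoeffDisc.of D).toRingHom)).map ψ) p →+ BdRPlusTop F p)
    (hφ₂s : ∀ (c : ℤ_[p]) τ, φ₂ (c • τ) = BdRPlusTop.of F p (qpToBdR (c : ℚ_[p])) * φ₂ τ)
    (hφ₂g : ∀ (σ : absoluteGaloisGroup F) τ, BdRPlusTop.gal F p σ (φ₂ τ) = φ₂ (σ • τ))
    (hNη : ∃ τ, φ₂ τ ∉ (BdRPlusTop.filOne F p).toIdeal) :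
    GaloisRep.IsDeRham (bdRPeriodRingData (F := F) (p := p) hp) (restrictedRationalTateRep W₀ F p) := by
  have hθ : Function.Surjective (WittVector.fontaineTheta (integerC F) p) := surjective_fontaineTheta_integerC hp
  have hp57 : p = 5 ∨ p = 7 := hcell.elim (fun h => Or.inl h.1) (fun h => Or.inr h.1)
  have hp2 : p ≠ 2 := by rcases hp57 with rfl | rfl <;> norm_num
  have hr₄ : p = 5 → 0 < r₄ := fun h5 => by
    rcases hcell with ⟨-, ⟨-, h, -⟩ | ⟨-, h, -⟩⟩ | ⟨h7, -⟩ <;> omega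
  have hr₆ : p = 7 → 0 < r₆ := fun h7 => by
    rcases hcell with ⟨h5, -⟩ | ⟨-, -, -, h, -⟩ <;> omega
  -- the residue characteristic
  haveI : CharP 𝓀[F] p := by
    refine (CharP.charP_iff_prime_eq_zero Fact.out).2 ?_
    rw [← map_natCast (IsLocalRing.residue 𝒪[F]), IsLocalRing.residue_eq_zero_iff, IsLocalRing.mem_maximalIdeal,
      mem_nonunits_iff, (Valuation.integer.integers (valuation F)).isUnit_iff_valuation_eq_one]
    rw [map_natCast]
    exact hp.ne
  -- the reduction data of `W♭ = W_D ⊗_β 𝒪_F = W ⊗_ψ 𝒪_F`, `β = ψ ∘ of`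
  have hΔ := AinfTop.isUnit_Δ_map_model (F := F) hD (ψ.comp (EisensteinRoot.CoeffDisc.of D).toRingHom) a b h₄ h₆ hu
  have hA := AinfTop.hasseCoeff_red_map_model_eq_zero hD (ψ.comp (EisensteinRoot.CoeffDisc.of D).toRingHom) a b hp57 hr₄ hr₆
  -- `W₀ ×_{K₀} F = (W ⊗_ψ 𝒪_F) ⊗ F`
  have hW' := hW.trans (AinfRamTop.curveFO_map_of_map_ψ _ ψ hψ).symm
  -- the Tate-module witness `τ₁ ≠ 0`
  obtain ⟨τ, hτ1, -⟩ :=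
    AinfTop.exists_tatePtO_norm_p_lt_norm_pow_model hD (ψ.comp (EisensteinRoot.CoeffDisc.of D).toRingHom) a b hp57 h₄ h₆ hu hr₄ hr₆
  -- (N1′): `∫_t ω ≠ 0` whenever `t₁ ≠ 0`
  have hN1seq : ∀ {t : ℕ → (maxNilIdealC F).toIdeal} (ht0 : (t 0 : CBall F) = 0)
      (htp : ∀ n, AinfRamTop.mulPC (((⟨0, 0, 0, AdjoinRoot.of D.poly a * AdjoinRoot.root D.poly ^ r₄,
        AdjoinRoot.of D.poly b * AdjoinRoot.root D.poly ^ r₆⟩ : WeierstrassCurve D.Coeff).map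
        (EisensteinRoot.CoeffDisc.of D).toRingHom)) (t (n + 1)) = t n),
      (t 1 : CBall F) ≠ 0 → AinfRamTop.omegaPeriod _ hθ t ht0 htp ≠ 0 := by
    intro t ht0 htp h1
    rcases hcell with ⟨rfl, hc⟩ | ⟨rfl, hc⟩
    · exact AinfRamTop.omegaPeriod_model_five_ne_zero hD a b
        (hc.elim (fun h => Or.inl ⟨h.1, h.2.1⟩) (fun h => Or.inr ⟨h.1, h.2.1⟩)) h₄ h₆ hu ht0 htp h1
    · exact AinfRamTop.omegaPeriod_model_seven_ne_zero hD a b ⟨hc.1, hc.2.2.1⟩ h₄ h₆ hu ht0 htp h1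
  have hN1 := AinfRamTop.exists_omegaPeriodHomO_ne_zero _ ψ (hψ := hψ) hN1seq ⟨τ, hτ1⟩
  -- socket
  exact isDeRham_restrictedRationalTateRep_of_periodHomsO hp W₀ _ hW' hp2 hΔ hA
    (AinfRamTop.omegaPeriodHomO _ ψ hθ hψ) φ₂ (AinfRamTop.omegaPeriodHomO_smul' _ ψ) hφ₂s
    (AinfRamTop.gal_omegaPeriodHomO _ ψ) hφ₂g (AinfRamTop.omegaPeriodHomO_mem_filOne _ ψ) hN1 hNη

end Literature.NumberTheory.PAdicHodge

end
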